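import Summits.Parity.GeneralizedHardyLittlewood.Theorems.HeathBrownPrimeAP3MainTerm

/-! # HeathBrownPrimeAP3 (2/3) — F2, the error terms: `errorTermBoundAP_holds : ErrorTermBoundAP` (item
stmt-Parity-19663 of `route-Parity-HeathBrownPrimeAP3`)

Ledger of record: tier A, ledger **FRONTIER**; no bearing on prime pairs / parity / GHL (tribunal J 2026-08-26).
`|T_{2N}(Λ, Λ, w) − T_{2N}(g_B, g_B, w)| ≤ C′ (2N)² (log 2N)^{(1−A)/4 + 3/2 + C₄/4}` (`w = apWeight c N`): two
applications of the Hölder counting lemma E5 (Literature `holderCounting_holds`) at scale `2N` with the E2-shape sup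
bound on `Λ̂ − ĝ_B` and the E4b-shape fourth moment of `f̂₃`, transported to `ŵ` by `integral_fourth_apWeight`. Sources: [Vaughan1997] (§3.1,
Lemma 2.5), [GreenTao2006Restriction], [Vaughan1986Cubes].

Theorems-side PORT of the cell evidence `pub/parity-ideate/parity-ideate-p2/evidence/LineEFG_tree.lean`
(KERNEL-PROVED there, farm rc 0, axioms std), re-namespaced into the route namespace (precedent
`Theorems/MaynardProductExactGlue.lean`) and re-based on the LANDED Literature modules `CubicMinorantDefs`
(p407241: the weights `vmWeight`, `gWeight`, `hbWeight`, `apWeight`, `ternarySum`, `expSumOf`),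
`TernaryHolderCounting` (E5, p410251), `RoughModelPairCount` (E6, p410680), `RoughModelFourierApprox`
(E2, p410505), `HeathBrownWeightFourthMoment` (E4b, p410644), whose public lemmas replace the evidence's local
copies. Notation: `T = ternarySum`, `Λ_N = vmWeight N`, `g_B = gWeight B N` (the `W`-rough model of level
`(log N)^B` on `[1, N]`), `f₃ = hbWeight c N` (Heath-Brown primes `x³+2y³` from the box
`X < x, y ≤ X(1+η)`, `X = (N/6)^{1/3}`, `η = (log X)^{-c}`, weight `N^{1/3} log`). Port prepared and
farm-checked by parity-ideate-p2 g5 (planner); filed by a prover seat. -/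

noncomputable section

open scoped FourierTransform ArithmeticFunction
open Finset MeasureTheory Filter

namespace Summit.Parity.GeneralizedHardyLittlewood.Theses.HeathBrownPrimeAP3

open Literature.NumberTheory.Sieve Literature.NumberTheory.Sieve.CubicPrimes
open Literature.NumberTheory.Sieve.CubicMinorant hiding RoughModelFourierApprox HBFourierFourthMoment
  roughModelFourierApprox_holds hbFourierFourthMoment_holds
open Literature.NumberTheory.Waring.HuaCubes
open Summit.Parity.GeneralizedHardyLittlewood.Theses.VinogradovHeathBrown hiding RoughModelFourierApprox
  HBFourierFourthMoment roughModelFourierApprox_holds hbFourierFourthMoment_holds Assembly assembly_holds closes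
open scoped Topology

section F2proof

/-- **F2 PROVED**: two applications of E5 at scale `2N`, with `∫₀¹ |ŵ|⁴ = ∫₀¹ |f̂₃|⁴ ≤ c₁ N³ (log N)^{C₄}
≤ c₁ (2N)³ (log 2N)^{C₄}`. [this line] -/
theorem errorTermBoundAP_holds : ErrorTermBoundAP := by
  intro c hc C₄ c₁ hC₄ h4 A B C hA hB N₂ h2
  have hev : ∀ᶠ N : ℕ in atTop, (2 : ℝ) ≤ Real.log N ^ B :=
    ((tendsto_rpow_atTop hB).comp
      (Real.tendsto_log_atTop.comp tendsto_natCast_atTop_atTop)).eventually_ge_atTop 2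
  obtain ⟨N₇, hN₇⟩ := Filter.eventually_atTop.1 hev
  have hC₀ : 0 < max C 1 := lt_max_of_lt_right one_pos
  have hc₁' : 0 < max c₁ 1 := lt_max_of_lt_right one_pos
  -- the constants
  refine ⟨(2 * max C 1) ^ ((1 : ℝ) / 4) * (8 * (1 + (Real.exp 5 * B) ^ 2)) ^ ((3 : ℝ) / 8) *
      (max c₁ 1) ^ ((1 : ℝ) / 4) +
    (2 * Real.exp 5 * B * max C 1) ^ ((1 : ℝ) / 4) *
      (8 * (Real.exp 5 * B) ^ 2 * (1 + (Real.exp 5 * B) ^ 2)) ^ ((3 : ℝ) / 8) *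
      (max c₁ 1) ^ ((1 : ℝ) / 4), N₂ + N₇ + 3, fun N hN => ?_⟩
  set M : ℕ := 2 * N with hMdef
  have hz := hN₇ M (by omega)
  have hN3 : 3 ≤ N := by omega
  have hM3 : 3 ≤ M := by omega
  have hNM : N ≤ M := by omega
  have hN0 : (0 : ℝ) < N := by exact_mod_cast (show 0 < N by omega)
  have hM0 : (0 : ℝ) < M := by exact_mod_cast (show 0 < M by omega)
  have hM1 : (1 : ℝ) ≤ M := by exact_mod_cast (show 1 ≤ M by omega)
  have hNM' : (N : ℝ) ≤ M := by exact_mod_cast hNM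
  have hLN1 : 1 ≤ Real.log N := by
    rw [Real.le_log_iff_exp_le hN0]
    have := Real.exp_one_lt_d9
    have h3 : (3 : ℝ) ≤ N := by exact_mod_cast hN3
    linarith
  have hLN0 : 0 < Real.log N := by linarith
  have hLNM : Real.log N ≤ Real.log M := Real.log_le_log hN0 hNM'
  have hL1 : 1 ≤ Real.log M := hLN1.trans hLNM
  have hL0 : 0 < Real.log M := by linarith
  have hcard : ((range (M + 1)).card : ℝ) = M + 1 := by rw [Finset.card_range]; push_cast; ring
  -- sup bounds
  have hU₁0 : 0 ≤ max C 1 * M * Real.log M ^ (-A) := by positivity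
  have hsup₁ : ∀ α : ℝ, ‖expSumOf (vmWeight M - gWeight B M) M α‖ ≤
      max C 1 * M * Real.log M ^ (-A) := by
    intro α
    rw [expSumOf_sub, expSumOf_vmWeight, expSumOf_gWeight]
    exact (h2 M (by omega) α).trans (mul_le_mul_of_nonneg_right
      (mul_le_mul_of_nonneg_right (le_max_left C 1) hM0.le) (Real.rpow_nonneg hL0.le _))
  have habsΛ : ∑ n ∈ range (M + 1), |vmWeight M n| ≤ 2 * M * Real.log M := by
    calc ∑ n ∈ range (M + 1), |vmWeight M n| ≤ ∑ n ∈ range (M + 1), Real.log M := by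
          refine Finset.sum_le_sum fun n hn => ?_
          rw [abs_of_nonneg (vmWeight_nonneg M n)]
          exact vmWeight_le_log (Nat.lt_succ_iff.1 (mem_range.1 hn))
      _ = (M + 1) * Real.log M := by rw [Finset.sum_const, nsmul_eq_mul, hcard]
      _ ≤ 2 * M * Real.log M := by
          have := mul_nonneg (sub_nonneg.2 hM1) hL0.le; linarith
  have hsupΛ : ∀ α : ℝ, ‖expSumOf (vmWeight M) M α‖ ≤ 2 * M * Real.log M :=
    fun α => (norm_expSumOf_le _ _ _).trans habsΛ
  have hgR := gWeight_le hB hz hL0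
  have hR0 : 0 ≤ Real.exp 5 * B * Real.log M := by positivity
  have habsg : ∑ n ∈ range (M + 1), |gWeight B M n| ≤ 2 * M * (Real.exp 5 * B * Real.log M) := by
    calc ∑ n ∈ range (M + 1), |gWeight B M n|
        ≤ ∑ n ∈ range (M + 1), Real.exp 5 * B * Real.log M := by
          refine Finset.sum_le_sum fun n _ => ?_
          rw [abs_of_nonneg (gWeight_nonneg B M n)]
          exact hgR n
      _ = (M + 1) * (Real.exp 5 * B * Real.log M) := by rw [Finset.sum_const, nsmul_eq_mul, hcard]
      _ ≤ 2 * M * (Real.exp 5 * B * Real.log M) := by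
          have := mul_nonneg (sub_nonneg.2 hM1) hR0; linarith
  have hsupg : ∀ α : ℝ, ‖expSumOf (gWeight B M) M α‖ ≤ 2 * M * (Real.exp 5 * B * Real.log M) :=
    fun α => (norm_expSumOf_le _ _ _).trans habsg
  -- ℓ² bounds
  have hsqΛ : ∑ n ∈ range (M + 1), vmWeight M n ^ 2 ≤ 2 * M * Real.log M ^ 2 := by
    calc ∑ n ∈ range (M + 1), vmWeight M n ^ 2 ≤ ∑ n ∈ range (M + 1), Real.log M ^ 2 := by
          refine Finset.sum_le_sum fun n hn => ?_
          exact pow_le_pow_left₀ (vmWeight_nonneg M n)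
            (vmWeight_le_log (Nat.lt_succ_iff.1 (mem_range.1 hn))) 2
      _ = (M + 1) * Real.log M ^ 2 := by rw [Finset.sum_const, nsmul_eq_mul, hcard]
      _ ≤ 2 * M * Real.log M ^ 2 := by
          have := mul_nonneg (sub_nonneg.2 hM1) (sq_nonneg (Real.log M)); linarith
  have hsqg : ∑ n ∈ range (M + 1), gWeight B M n ^ 2 ≤
      2 * M * (Real.exp 5 * B * Real.log M) ^ 2 := by
    calc ∑ n ∈ range (M + 1), gWeight B M n ^ 2
        ≤ ∑ n ∈ range (M + 1), (Real.exp 5 * B * Real.log M) ^ 2 := by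
          refine Finset.sum_le_sum fun n _ => ?_
          exact pow_le_pow_left₀ (gWeight_nonneg B M n) (hgR n) 2
      _ = (M + 1) * (Real.exp 5 * B * Real.log M) ^ 2 := by
          rw [Finset.sum_const, nsmul_eq_mul, hcard]
      _ ≤ 2 * M * (Real.exp 5 * B * Real.log M) ^ 2 := by
          have := mul_nonneg (sub_nonneg.2 hM1) (sq_nonneg (Real.exp 5 * B * Real.log M))
          linarith
  have hsqd : ∑ n ∈ range (M + 1), (vmWeight M - gWeight B M) n ^ 2 ≤
      4 * (1 + (Real.exp 5 * B) ^ 2) * M * Real.log M ^ 2 := by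
    calc ∑ n ∈ range (M + 1), (vmWeight M - gWeight B M) n ^ 2
        ≤ ∑ n ∈ range (M + 1), (2 * vmWeight M n ^ 2 + 2 * gWeight B M n ^ 2) := by
          refine Finset.sum_le_sum fun n _ => ?_
          rw [Pi.sub_apply]
          nlinarith [sq_nonneg (vmWeight M n + gWeight B M n)]
      _ = 2 * ∑ n ∈ range (M + 1), vmWeight M n ^ 2 + 2 * ∑ n ∈ range (M + 1), gWeight B M n ^ 2 := by
          rw [Finset.sum_add_distrib, Finset.mul_sum, Finset.mul_sum]
      _ ≤ 2 * (2 * M * Real.log M ^ 2) + 2 * (2 * M * (Real.exp 5 * B * Real.log M) ^ 2) := by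
          linarith
      _ = 4 * (1 + (Real.exp 5 * B) ^ 2) * M * Real.log M ^ 2 := by ring
  -- the fourth moment: `∫ |ŵ|⁴ = ∫ |f̂₃|⁴ ≤ c₁ N³ (log N)^{C₄} ≤ max(c₁,1) M³ (log M)^{C₄}`
  have hI0 : 0 ≤ ∫ α in (0 : ℝ)..1, ‖expSumOf (apWeight c N) M α‖ ^ 4 :=
    intervalIntegral.integral_nonneg zero_le_one fun α _ => by positivity
  have hI : ∫ α in (0 : ℝ)..1, ‖expSumOf (apWeight c N) M α‖ ^ 4 ≤
      max c₁ 1 * (M : ℝ) ^ 3 * Real.log M ^ C₄ := by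
    have hI4 := integral_fourth_apWeight c N
    rw [← hMdef] at hI4
    rw [hI4]
    refine (h4 N hN3).trans ?_
    have hM3' : (N : ℝ) ^ 3 ≤ (M : ℝ) ^ 3 := pow_le_pow_left₀ hN0.le hNM' 3
    calc c₁ * (N : ℝ) ^ 3 * Real.log N ^ C₄ ≤ max c₁ 1 * (N : ℝ) ^ 3 * Real.log N ^ C₄ :=
          mul_le_mul_of_nonneg_right (mul_le_mul_of_nonneg_right (le_max_left c₁ 1)
            (by positivity)) (Real.rpow_nonneg hLN0.le _)
      _ ≤ max c₁ 1 * (M : ℝ) ^ 3 * Real.log M ^ C₄ :=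
          mul_le_mul (mul_le_mul_of_nonneg_left hM3' hc₁'.le)
            (Real.rpow_le_rpow hLN0.le hLNM hC₄) (Real.rpow_nonneg hLN0.le _) (by positivity)
  have hL4 : Real.log M ^ 2 * Real.log M ^ 2 = Real.log M ^ (4 : ℝ) := by
    rw [show Real.log M ^ (4 : ℝ) = Real.log M ^ (4 : ℕ) by exact_mod_cast Real.rpow_natCast _ 4]
    ring
  have hLA : Real.log M ^ (-A) * Real.log M = Real.log M ^ (1 - A) := by
    rw [show (1 : ℝ) - A = -A + 1 by ring, Real.rpow_add_one hL0.ne']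
  -- term 1: `T(Λ − g, Λ, w)`
  have hT₁ := holderCounting_holds (vmWeight M - gWeight B M) (vmWeight M) (apWeight c N) M
    _ _ hU₁0 (by positivity) hsup₁ hsupΛ
  have hS₁0 : 0 ≤ (∑ n ∈ range (M + 1), (vmWeight M - gWeight B M) n ^ 2) *
      ∑ n ∈ range (M + 1), vmWeight M n ^ 2 :=
    mul_nonneg (Finset.sum_nonneg fun n _ => sq_nonneg _) (Finset.sum_nonneg fun n _ => sq_nonneg _)
  have hS₁ : (∑ n ∈ range (M + 1), (vmWeight M - gWeight B M) n ^ 2) *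
      ∑ n ∈ range (M + 1), vmWeight M n ^ 2 ≤
      8 * (1 + (Real.exp 5 * B) ^ 2) * M ^ 2 * Real.log M ^ (4 : ℝ) := by
    calc (∑ n ∈ range (M + 1), (vmWeight M - gWeight B M) n ^ 2) *
          ∑ n ∈ range (M + 1), vmWeight M n ^ 2
        ≤ (4 * (1 + (Real.exp 5 * B) ^ 2) * M * Real.log M ^ 2) * (2 * M * Real.log M ^ 2) :=
          mul_le_mul hsqd hsqΛ (Finset.sum_nonneg fun n _ => sq_nonneg _) (by positivity)
      _ = 8 * (1 + (Real.exp 5 * B) ^ 2) * M ^ 2 * (Real.log M ^ 2 * Real.log M ^ 2) := by ring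
      _ = _ := by rw [hL4]
  have hb₁ := holder_to_monomial
    (T := ternarySum (vmWeight M - gWeight B M) (vmWeight M) (apWeight c N) M)
    hM0 hL0 (by positivity : (0 : ℝ) ≤ 2 * max C 1) (by positivity) hc₁'.le hT₁
    (by rw [← hLA]; ring) hS₁0 hS₁ hI0 hI
  -- term 2: `T(g, Λ − g, w)`
  have hT₂ := holderCounting_holds (gWeight B M) (vmWeight M - gWeight B M) (apWeight c N) M
    _ _ (by positivity) hU₁0 hsupg hsup₁
  have hS₂0 : 0 ≤ (∑ n ∈ range (M + 1), gWeight B M n ^ 2) *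
      ∑ n ∈ range (M + 1), (vmWeight M - gWeight B M) n ^ 2 :=
    mul_nonneg (Finset.sum_nonneg fun n _ => sq_nonneg _) (Finset.sum_nonneg fun n _ => sq_nonneg _)
  have hS₂ : (∑ n ∈ range (M + 1), gWeight B M n ^ 2) *
      ∑ n ∈ range (M + 1), (vmWeight M - gWeight B M) n ^ 2 ≤
      8 * (Real.exp 5 * B) ^ 2 * (1 + (Real.exp 5 * B) ^ 2) * M ^ 2 * Real.log M ^ (4 : ℝ) := by
    calc (∑ n ∈ range (M + 1), gWeight B M n ^ 2) *
          ∑ n ∈ range (M + 1), (vmWeight M - gWeight B M) n ^ 2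
        ≤ (2 * M * (Real.exp 5 * B * Real.log M) ^ 2) *
            (4 * (1 + (Real.exp 5 * B) ^ 2) * M * Real.log M ^ 2) :=
          mul_le_mul hsqg hsqd (Finset.sum_nonneg fun n _ => sq_nonneg _) (by positivity)
      _ = 8 * (Real.exp 5 * B) ^ 2 * (1 + (Real.exp 5 * B) ^ 2) * M ^ 2 *
            (Real.log M ^ 2 * Real.log M ^ 2) := by ring
      _ = _ := by rw [hL4]
  have hb₂ := holder_to_monomial
    (T := ternarySum (gWeight B M) (vmWeight M - gWeight B M) (apWeight c N) M)
    hM0 hL0 (by positivity : (0 : ℝ) ≤ 2 * Real.exp 5 * B * max C 1) (by positivity) hc₁'.le hT₂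
    (by rw [← hLA]; ring) hS₂0 hS₂ hI0 hI
  -- combine
  rw [ternarySum_sub_sub]
  refine (abs_add_le _ _).trans ?_
  have hsum := add_le_add hb₁ hb₂
  refine hsum.trans (le_of_eq ?_)
  ring

end F2proof

end Summit.Parity.GeneralizedHardyLittlewood.Theses.HeathBrownPrimeAP3

end
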